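import Summits.BirchSwinnertonDyer.BirchSwinnertonDyer.Theorems.PrintCf2RamifiedOffTYZSelmerRankOneMoverSix
import Literature.NumberTheory.EllipticCurves.Smith2016.CongruentNumberRedeiDeterminantEven
import HarnessLib

/-!
# Crux `PrintCf2.RamifiedOffTYZOfFacts` (stmt-BirchSwinnertonDyer-20509), line `offtyz-v7`, LEAD cycle 10 (cruxlead-20509 g9):
# THE `s = 1`, `n ≡ 6 (mod 8)` STRATUM WITH INTRINSIC HYPOTHESES — the genus regime of an even block `2d_S ≡ 6 (mod 8)` IS
# «`g(2d_S)` odd» (`⟺ 4 ∤` the exponent-`4` part of `Cl(ℚ(√−2d_S))`, Rédei–Reichardt, a tree theorem), and it already forces `#ker N_{2d_S} = 2`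
# and, at `S = univ`, a Selmer class with non-zero first block (programme F3, part IV)

THEOREMS ONLY (no `def`, no named fact, no `sorry`), `--supports stmt-BirchSwinnertonDyer-20509`.
* §1 (linear algebra over `𝔽₂`) `card_ker_fromBlocks_eq_two_of_det`: for an invertible `B′` (`det B′ = 1`) and a vector `t` with `Σ t = 1`, the
  matrix `[[B′ + t tᵀ, B′𝟙],[0, 0]]` has EXACTLY two kernel vectors (with `w* = B′⁻¹t`, `c = t·w*`: the kernel is `{0, (𝟙 + w*; 1)}` if `c = 0`
  and `{0, (w*; 0)}` if `c = 1`).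
* §2 Monsky's data on a block tuple `q` with `∏ q ≡ 3 (mod 4)`: `A + D₋₂ = (Aᵀ + D_z) + t tᵀ` (reciprocity `A + Aᵀ = D₋₁ + t tᵀ`, `D₋₂ = D₋₁ + D₂`),
  `(Aᵀ + D_z)·𝟙 = z` (column sums of `A` vanish), `det(Aᵀ + D_z) = det(A + D_z)`; so **`g(2d) odd ⟹ #ker N_d = 2`**
  (`card_ker_blockN_eq_two_of_odd_gK`, with Smith's Table 1 row `n ≡ 2 (4)`: `g(2d) odd ⟺ det(A + D_z) = 1`, tree theorem
  `odd_genusClassNumber_genusField_two_mul_iff_det`).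
* §3 **`g(n) odd ⟹` the Selmer class `u = kerSum M_even` has `u_{inl i} = 1` for some `i`** (`exists_kerSum_monskyEven_inl_eq_one`): a kernel vector
  `(0; u²)` of `[[Aᵀ+D₂, D₋₁],[D₂, A+D₂]]` has `(A + D₂)u² = 0`, impossible for `det(A + D₂) = 1`.
* §4 **`rankOne_sha_bsdp_two_of_card_selmer_eight_six_genus`**: for `n = 2p₁⋯p_k ≡ 6 (mod 8)` with `#Sel₂(E_n) = 8`, granted the printed TYZ §3
  displays + the conductor-`4` Frobenius clause + Thm 1.1, and the ONE arithmetic hypothesis «`g(2d_S)` is odd for every `S` with `d_S ≡ 3 (mod 4)`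
  and `coblockWeight p S = 1`» (at `S = univ`: `g(n)` odd, i.e. no class of order `4` in `Cl(ℚ(√−n))`; for `S ≠ univ` only the blocks with
  `|𝓛(n/2d_S)|` odd matter): `ord_{s=1} L(E_n,s) = rank E_n(ℚ) = 1`, `Ш(E_n)[2^∞] = 0`, `BSD(E_n, 2)`.
Per the LEAD g8's census (`Lines/offtyz_v7_SevenSector.md` §9) this is new coverage beyond Tian–Yuan–Zhang's Thm 1.2 (≈ 27 % of the `s = 1` stratum
at `k ≤ 4`). BSD is not proved by any of this; no class is closed by this file (a conditional result toward item 23432).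

References: [cite: TianYuanZhang2017, Thm. 1.1, §3.1, Prop. 3.2 (2), Thm. 3.5, Thm. 3.6 (2), Lemma 3.18, proof of Lemma 3.21]; [cite: Smith2016CongruentDensity,
§2 Table 1 row n ≡ 2 (4), Thm. 1.2]; [cite: LiMa2008, Thm. 0.4]; [cite: HeathBrown1994SelmerCongruentII, Appendix (Monsky), typescript p. 39 L10 – p. 41 L36];
[cite: HornJohnson2013, §0.8.2]; crux notes `Lines/offtyz_v7_SevenSector.md` §9–§10.
-/

noncomputable section

open scoped Classical NumberField

open WeierstrassCurve WeierstrassCurve.Affine Finset Matrix Literature.NumberTheory.EllipticCurves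
  Literature.NumberTheory.EllipticCurves.TianYuanZhang2017
  Literature.NumberTheory.EllipticCurves.TianYuanZhang2017.W2
  Literature.NumberTheory.EllipticCurves.HeathBrown1994
  Literature.NumberTheory.EllipticCurves.HeathBrown1994.Families
  Literature.NumberTheory.EllipticCurves.Smith2016
  Literature.NumberTheory.EllipticCurves.MonskySelmerParity
  Literature.NumberTheory.QuadraticFields.RingClass
  Literature.NumberTheory.QuadraticFields
  Literature.LinearAlgebra.Matrix
  Summit.BirchSwinnertonDyer.Rank1Residual.P2.GenusPeriodTransferLayer
  Summit.BirchSwinnertonDyer.PrintCf2.QForm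
  Summit.BirchSwinnertonDyer.PrintCf2.QFormForest

set_option autoImplicit false

namespace Summit.BirchSwinnertonDyer.PrintCf2.MoverAssembly

/-! ## §1 `[[B′ + t tᵀ, B′𝟙],[0, 0]]` has a two-element kernel (`det B′ = 1`, `Σ t = 1`) -/

section KernelTwo

variable {m : ℕ}

/-- **The kernel of `[[B′ + t tᵀ, B′𝟙],[0, 0]]` has exactly two elements** when `det B′ = 1` and `Σ t = 1` (over `𝔽₂`): writing a kernel vector as
`(w; a)`, `B′w + (t·w) t = a B′𝟙` gives `w = (t·w) w* + a𝟙` with `w* = adj(B′) t`; dotting with `t` (`t·𝟙 = 1`) gives `a = (t·w)(1 + t·w*)`, so the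
kernel vectors are parametrised by the bit `t·w`. [cite: HornJohnson2013, §0.8.2 (adjugate and Cramer's rule)] -/
theorem card_ker_fromBlocks_eq_two_of_det (B' : Matrix (Fin m) (Fin m) (ZMod 2)) (hdet : B'.det = 1) (t : Fin m → ZMod 2)
    (ht : ∑ j, t j = 1) :
    Fintype.card {v : Fin m ⊕ Unit → ZMod 2 //
      (Matrix.fromBlocks (B' + vecMulVec t t) (Matrix.of fun j (_ : Unit) => (B' *ᵥ fun _ => (1 : ZMod 2)) j)
        (0 : Matrix Unit (Fin m) (ZMod 2)) (0 : Matrix Unit Unit (ZMod 2))) *ᵥ v = 0} = 2 := by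
  set N := Matrix.fromBlocks (B' + vecMulVec t t) (Matrix.of fun j (_ : Unit) => (B' *ᵥ fun _ => (1 : ZMod 2)) j)
    (0 : Matrix Unit (Fin m) (ZMod 2)) (0 : Matrix Unit Unit (ZMod 2)) with hN
  set one : Fin m → ZMod 2 := fun _ => 1 with hone
  set ws : Fin m → ZMod 2 := B'.adjugate *ᵥ t with hws
  have hBws : B' *ᵥ ws = t := by rw [hws, mulVec_mulVec, mul_adjugate, hdet, one_smul, one_mulVec]
  have hadjB : ∀ w : Fin m → ZMod 2, B'.adjugate *ᵥ (B' *ᵥ w) = w := fun w => by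
    rw [mulVec_mulVec, adjugate_mul, hdet, one_smul, one_mulVec]
  have e2 : ∀ u v : ZMod 2, u + v = 0 ↔ u = v := by decide
  have hval : ∀ x : ZMod 2, x = 0 ∨ x = 1 := by decide
  -- the entries of `N v`
  have hNv : ∀ (v : Fin m ⊕ Unit → ZMod 2) (j : Fin m), (N *ᵥ v) (Sum.inl j) =
      (B' *ᵥ fun j' => v (Sum.inl j')) j + (t ⬝ᵥ fun j' => v (Sum.inl j')) * t j + (B' *ᵥ one) j * v (Sum.inr ()) := by
    intro v j
    rw [mulVec, dotProduct, Fintype.sum_sum_type]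
    simp only [hN, fromBlocks_apply₁₁, fromBlocks_apply₁₂, Matrix.add_apply, vecMulVec_apply, Matrix.of_apply, univ_unique,
      sum_singleton, add_mul, sum_add_distrib, mulVec, dotProduct]
    have hmid : ∑ x, t j * t x * v (Sum.inl x) = (∑ x, t x * v (Sum.inl x)) * t j := by
      rw [Finset.sum_mul]; exact Finset.sum_congr rfl fun x _ => by ring
    rw [hmid]
  have hNv' : ∀ (v : Fin m ⊕ Unit → ZMod 2) (u : Unit), (N *ᵥ v) (Sum.inr u) = 0 := by
    intro v u
    rw [mulVec, dotProduct]
    refine Finset.sum_eq_zero fun c _ => ?_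
    rcases c with j | u'
    · rw [hN, fromBlocks_apply₂₁, Matrix.zero_apply, zero_mul]
    · rw [hN, fromBlocks_apply₂₂, Matrix.zero_apply, zero_mul]
  -- the kernel equation: `w = (t·w) • w* + a • 𝟙`
  have hker : ∀ v : Fin m ⊕ Unit → ZMod 2, N *ᵥ v = 0 ↔
      (fun j' => v (Sum.inl j')) = (t ⬝ᵥ fun j' => v (Sum.inl j')) • ws + v (Sum.inr ()) • one := by
    intro v
    have hvec : N *ᵥ v = 0 ↔
        B' *ᵥ (fun j' => v (Sum.inl j')) = (t ⬝ᵥ fun j' => v (Sum.inl j')) • t + v (Sum.inr ()) • (B' *ᵥ one) := by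
      constructor
      · intro h; funext j
        have hj := congrFun h (Sum.inl j)
        rw [hNv, Pi.zero_apply, add_assoc, e2] at hj
        rw [hj, Pi.add_apply, Pi.smul_apply, Pi.smul_apply, smul_eq_mul, smul_eq_mul]; ring
      · intro h; funext c
        rcases c with j | u
        · rw [hNv, Pi.zero_apply, add_assoc, e2, congrFun h j, Pi.add_apply, Pi.smul_apply, Pi.smul_apply, smul_eq_mul, smul_eq_mul]
          ring
        · exact hNv' v u
    rw [hvec]
    constructor
    · intro h
      have h3 := congrArg (fun x => B'.adjugate *ᵥ x) h
      simp only [hadjB, mulVec_add, mulVec_smul] at h3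
      exact h3
    · intro h
      conv_lhs => rw [h]
      rw [mulVec_add, mulVec_smul, mulVec_smul, hBws]
  -- the bit `t·w` determines `a`: `a = (t·w)(1 + c)`, `c = t·w*`
  set c := t ⬝ᵥ ws with hc
  have ht1 : t ⬝ᵥ one = 1 := by rw [dotProduct]; simp only [hone, mul_one]; exact ht
  have hbit : ∀ v : Fin m ⊕ Unit → ZMod 2, N *ᵥ v = 0 → v (Sum.inr ()) = (t ⬝ᵥ fun j' => v (Sum.inl j')) * (1 + c) := by
    intro v hv
    rw [hker] at hv
    have hd := congrArg (fun x => t ⬝ᵥ x) hv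
    simp only [dotProduct_add, dotProduct_smul, smul_eq_mul, ← hc, ht1, mul_one] at hd
    have e3 : ∀ x y cc : ZMod 2, x = x * cc + y → y = x * (1 + cc) := by decide
    exact e3 _ _ _ hd
  -- the kernel vector with bit `β`
  set vβ : ZMod 2 → (Fin m ⊕ Unit → ZMod 2) := fun β => Sum.elim (β • ws + (β * (1 + c)) • one) (fun _ => β * (1 + c)) with hvβ
  have hvβker : ∀ β, N *ᵥ vβ β = 0 := by
    intro β
    rw [hker]
    have hw : (fun j' => vβ β (Sum.inl j')) = β • ws + (β * (1 + c)) • one := by funext j'; simp [hvβ]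
    have ha : vβ β (Sum.inr ()) = β * (1 + c) := by simp [hvβ]
    rw [hw, ha, dotProduct_add, dotProduct_smul, dotProduct_smul, ← hc, ht1, smul_eq_mul, smul_eq_mul, mul_one]
    congr 1
    have e4 : ∀ x cc : ZMod 2, x = x * cc + x * (1 + cc) := by decide
    rw [← e4]
  have hvβ_of_ker : ∀ v, N *ᵥ v = 0 → v = vβ (t ⬝ᵥ fun j' => v (Sum.inl j')) := by
    intro v hv
    have hb := hbit v hv
    rw [hker] at hv
    funext cc
    rcases cc with j | u
    · have := congrFun hv j
      simp only [hvβ, Sum.elim_inl]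
      rw [← hb]; exact this
    · simp only [hvβ, Sum.elim_inr]
      rw [← hb]
  have hvβ_inj : vβ 0 ≠ vβ 1 := by
    intro h
    have h1 := hbit _ (hvβker 1)
    have hbit1 : (t ⬝ᵥ fun j' => vβ 1 (Sum.inl j')) = 1 := by
      have hw : (fun j' => vβ 1 (Sum.inl j')) = (1 : ZMod 2) • ws + ((1 : ZMod 2) * (1 + c)) • one := by funext j'; simp [hvβ]
      rw [hw, dotProduct_add, dotProduct_smul, dotProduct_smul, ← hc, ht1]
      simp only [smul_eq_mul, one_mul, mul_one]
      have e5 : ∀ cc : ZMod 2, cc + (1 + cc) = 1 := by decide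
      exact e5 c
    have hbit0 : (t ⬝ᵥ fun j' => vβ 0 (Sum.inl j')) = 0 := by
      have hw : (fun j' => vβ 0 (Sum.inl j')) = 0 := by funext j'; simp [hvβ]
      rw [hw, dotProduct_zero]
    rw [h] at hbit0
    rw [hbit0] at hbit1
    exact zero_ne_one hbit1
  have hv0 : vβ 0 = 0 := by funext cc; rcases cc with j | u <;> simp [hvβ]
  rw [← Nat.card_eq_fintype_card, Nat.card_eq_two_iff' (⟨0, mulVec_zero N⟩ : {v // N *ᵥ v = 0})]
  refine ⟨⟨vβ 1, hvβker 1⟩, fun h => hvβ_inj (hv0.trans (congrArg Subtype.val h).symm), fun y hy => Subtype.ext ?_⟩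
  have hy' := hvβ_of_ker y.1 y.2
  rcases hval (t ⬝ᵥ fun j' => y.1 (Sum.inl j')) with h0 | h1
  · rw [h0, hv0] at hy'; exact absurd (Subtype.ext hy') hy
  · rw [h1] at hy'; exact hy'

end KernelTwo

/-! ## §2 Monsky's data: `g(2d) odd ⟹ #ker N_d = 2` -/

section Block

variable {m : ℕ} (q : Fin m → ℕ) (hq : ∀ j, (q j).Prime) (hqodd : ∀ j, Odd (q j)) (hqinj : Function.Injective q)

include hq hqodd hqinj in
/-- **`A + D₋₂ = (Aᵀ + D₂) + t tᵀ`** (`A + Aᵀ = D₋₁ + t tᵀ` and `D₋₂ = D₋₁ + D₂`). [cite: HeathBrown1994SelmerCongruentII, Appendix (Monsky), typescript p. 39 L36–L41] -/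
theorem legendreMatrix_add_diagonal_negTwo_eq :
    legendreMatrix q + legendreDiagonal q (-2) =
      ((legendreMatrix q)ᵀ + legendreDiagonal q 2) + vecMulVec (fun j => addLegendreSym (-1) (q j)) (fun j => addLegendreSym (-1) (q j)) := by
  have hq2 := ne_two_of_odd q hqodd
  have hrec := legendreMatrix_add_transpose q hq hq2 hqinj
  have hD : legendreDiagonal q (-2) = legendreDiagonal q (-1) + legendreDiagonal q 2 := by
    rw [legendreDiagonal, legendreDiagonal, legendreDiagonal, diagonal_add]
    congr 1; funext j
    exact Literature.NumberTheory.EllipticCurves.CongruentNumberOddMonskySelmer.addLegendreSym_neg_two (hq j) (hq2 j)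
  -- `A = D₋₁ + t tᵀ + Aᵀ` (characteristic 2)
  have hAT : (legendreMatrix q)ᵀ + (legendreMatrix q)ᵀ = 0 := by ext i j; exact CharTwo.add_self_eq_zero _
  have hA : legendreMatrix q = legendreDiagonal q (-1) +
      vecMulVec (fun j => addLegendreSym (-1) (q j)) (fun j => addLegendreSym (-1) (q j)) + (legendreMatrix q)ᵀ := by
    calc legendreMatrix q = legendreMatrix q + ((legendreMatrix q)ᵀ + (legendreMatrix q)ᵀ) := by rw [hAT, add_zero]
      _ = (legendreMatrix q + (legendreMatrix q)ᵀ) + (legendreMatrix q)ᵀ := by rw [add_assoc]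
      _ = _ := by rw [hrec]
  have h0 : legendreDiagonal q (-1) + legendreDiagonal q (-1) = 0 := by ext i j; exact CharTwo.add_self_eq_zero _
  rw [hD]
  conv_lhs => rw [hA]
  calc _ = ((legendreMatrix q)ᵀ + legendreDiagonal q 2) + vecMulVec (fun j => addLegendreSym (-1) (q j)) (fun j => addLegendreSym (-1) (q j)) +
        (legendreDiagonal q (-1) + legendreDiagonal q (-1)) := by abel
    _ = _ := by rw [h0, add_zero]

include hq hqodd hqinj in
/-- **`(Aᵀ + D₂)·𝟙 = z`** for `∏ q ≡ 3 (mod 4)` (the column sums of `A` vanish). [cite: HeathBrown1994SelmerCongruentII, Appendix (Monsky), typescript p. 39 L49 – p. 40 L1] -/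
theorem legendreMatrixT_add_diagonal_two_mulVec_one (h4 : ∑ j, addLegendreSym (-1) (q j) = 1) :
    ((legendreMatrix q)ᵀ + legendreDiagonal q 2) *ᵥ (fun _ => (1 : ZMod 2)) = fun j => addLegendreSym 2 (q j) := by
  rw [add_mulVec, mulVec_transpose]
  have h1 : (fun _ => (1 : ZMod 2)) ᵥ* legendreMatrix q = 0 := by
    have h := one_vecMul_legendreMatrix q hq (ne_two_of_odd q hqodd) hqinj
    rw [h4, show (1 : ZMod 2) + 1 = 0 by decide, zero_smul] at h
    exact h
  rw [h1, zero_add]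
  funext j
  rw [legendreDiagonal, mulVec_diagonal, mul_one]

include hq hqodd hqinj in
/-- **`g(2d) odd ⟹ #ker N_d = 2`** for a block tuple `q` with `d = ∏ q ≡ 3 (mod 4)`: by Smith's Table 1 row `n ≡ 2 (4)` (tree theorem, via
Rédei–Reichardt) `g(2d)` odd iff `det(A + D₂) = 1`, and then `[[A + D₋₂, z],[0,0]] = [[B′ + t tᵀ, B′𝟙],[0,0]]` with `B′ = Aᵀ + D₂` invertible.
[cite: Smith2016CongruentDensity, §2 Table 1 (row n ≡ 2 (4))] [cite: LiMa2008, Thm. 0.4] -/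
theorem card_ker_blockN_eq_two_of_odd_gK (h4 : ∑ j, addLegendreSym (-1) (q j) = 1) (hg : Odd (gK (2 * ∏ j, q j))) :
    Fintype.card {v : Fin m ⊕ Unit → ZMod 2 //
      (Matrix.fromBlocks (legendreMatrix q + legendreDiagonal q (-2)) (Matrix.of fun j (_ : Unit) => addLegendreSym 2 (q j))
        (0 : Matrix Unit (Fin m) (ZMod 2)) (0 : Matrix Unit Unit (ZMod 2))) *ᵥ v = 0} = 2 := by
  have hdet : (legendreMatrix q + legendreDiagonal q 2).det = 1 :=
    (odd_genusClassNumber_genusField_two_mul_iff_det q hq hqodd hqinj).mp hg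
  have hdetT : ((legendreMatrix q)ᵀ + legendreDiagonal q 2).det = 1 := by
    rw [← det_transpose, transpose_add, transpose_transpose, legendreDiagonal, diagonal_transpose]; exact hdet
  have h := card_ker_fromBlocks_eq_two_of_det _ hdetT _ h4
  rw [legendreMatrixT_add_diagonal_two_mulVec_one q hq hqodd hqinj h4, ← legendreMatrix_add_diagonal_negTwo_eq q hq hqodd hqinj] at h
  exact h

end Block

/-! ## §3 `g(n) odd ⟹` the Selmer class has a non-zero first block -/

section FirstBlock

variable {k : ℕ} (p : Fin k → ℕ) (hp : ∀ i, (p i).Prime) (hodd : ∀ i, Odd (p i)) (hinj : Function.Injective p)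

include hp hodd hinj in
/-- **`g(2m)` odd ⟹ the Selmer class of `E_{2m}` has a non-zero FIRST block**: for `#Sel₂(E_{2m}) = 8` the kernel generator `u` of Monsky's even matrix
`[[Aᵀ + D₂, D₋₁],[D₂, A + D₂]]` satisfies `u_{inl i} = 1` for some `i` — otherwise `(A + D₂) u² = 0` with `u² ≠ 0`, contradicting `det(A + D₂) = 1`
(`⟺ g(2m)` odd, Smith's Table 1 via Rédei–Reichardt). [cite: Smith2016CongruentDensity, §2 Table 1 (row n ≡ 2 (4))] [cite: HeathBrown1994SelmerCongruentII, Appendix (Monsky), typescript p. 41 L20–L36] -/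
theorem exists_kerSum_monskyEven_inl_eq_one (hsel : Nat.card ((congruentNumberCurve (2 * ∏ i, p i)).selmerGroup 2) = 8)
    (hg : Odd (gK (2 * ∏ i, p i))) : ∃ i, kerSum (monskyMatrixEven p) (Sum.inl i) = 1 := by
  have hdet : (legendreMatrix p + legendreDiagonal p 2).det = 1 :=
    (odd_genusClassNumber_genusField_two_mul_iff_det p hp hodd hinj).mp hg
  obtain ⟨hne, hker⟩ := ker_iff_of_card_eq_two _ (card_ker_monskyEven_eq_two_of_card_selmer_eight p hp hodd hinj hsel)
  set u := kerSum (monskyMatrixEven p) with hu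
  have hMu : monskyMatrixEven p *ᵥ u = 0 := (hker u).mpr (Or.inr rfl)
  by_contra hall
  push Not at hall
  have hval : ∀ x : ZMod 2, x = 0 ∨ x = 1 := by decide
  have h1 : ∀ i, u (Sum.inl i) = 0 := fun i => (hval _).resolve_right (hall i)
  have hzero1 : (u ∘ Sum.inl) = 0 := funext h1
  rw [monskyMatrixEven, fromBlocks_mulVec, hzero1, mulVec_zero, mulVec_zero, zero_add, zero_add] at hMu
  have h2 : (legendreMatrix p + legendreDiagonal p 2) *ᵥ (u ∘ Sum.inr) = 0 := by
    funext j
    have := congrFun hMu (Sum.inr j)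
    rwa [Sum.elim_inr] at this
  have hu2 : (u ∘ Sum.inr) = 0 := by
    have h3 := congrArg (fun v => (legendreMatrix p + legendreDiagonal p 2).adjugate *ᵥ v) h2
    simp only [mulVec_mulVec, adjugate_mul, hdet, one_smul, one_mulVec, mulVec_zero] at h3
    exact h3
  apply hne
  funext c; rcases c with i | i
  · exact congrFun hzero1 i
  · exact congrFun hu2 i

end FirstBlock

/-! ## §4 The theorem with intrinsic hypotheses -/

variable {k : ℕ} (p : Fin k → ℕ) (hp : ∀ i, (p i).Prime) (hodd : ∀ i, Odd (p i)) (hinj : Function.Injective p)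
variable {n : ℕ} (D : GenusPointData n)

include hp hodd hinj in
/-- **THE `s = 1` STRATUM FOR `n ≡ 6 (mod 8)`, GENUS FORM.**  For `n = 2p₁⋯p_k` with `p₁⋯p_k ≡ 3 (mod 4)` and `#Sel⁽²⁾(E_n/ℚ) = 8`, granted the
printed Tian–Yuan–Zhang §3 data on `n` (genus-point displays `recursion`, `thm35Main`, `scriptLSpec`, `lemma318`; the CM-point layer on every block
with ONE complex conjugation; on every block `d ≡ 6 (mod 8)` the lift `θ_d` of `σ_{1+ϖ}` and the conductor-`4` Frobenius clause of Prop. 3.2 (2) /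
Cox §9.A, displayed as a hypothesis), TYZ Thm 1.1, and the ONE arithmetic hypothesis
  «`g(2d_S) = #2Cl(ℚ(√−2d_S))` is ODD for every `S` with `d_S ≡ 3 (mod 4)` and `coblockWeight p S = 1`»
(at `S = univ`: `4 ∤ #Cl(ℚ(√−n))[4]`-part, i.e. `g(n)` odd; for `S ≠ univ` only the blocks with `|𝓛(n/2d_S)|` odd matter):
`ord_{s=1} L(E_n, s) = 1`, `rank E_n(ℚ) = 1`, `Ш(E_n/ℚ)[2^∞] = 0`, and `BSD(E_n, 2)`.
[cite: TianYuanZhang2017, Thm. 1.1, §3.1, Prop. 3.2 (2), Thm. 3.5, Thm. 3.6 (2), Lemma 3.18, proof of Lemma 3.21]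
[cite: Smith2016CongruentDensity, §2 Table 1, Thm. 1.2] [cite: LiMa2008, Thm. 0.4] [cite: HeathBrown1994SelmerCongruentII, Appendix (Monsky), typescript p. 41 L20–L36] -/
theorem rankOne_sha_bsdp_two_of_card_selmer_eight_six_genus (hn : n = 2 * ∏ i, p i) (h3 : (∏ i, p i) % 4 = 3)
    (hrec : D.recursion) (h35 : D.thm35Main) (hLs : D.scriptLSpec) (h318 : D.lemma318)
    (z : ℕ → APoint D.H) (Φ : ℕ → Finset (D.H ≃ₐ[ℚ] D.H)) (ΓH ΓH' : ℕ → Subgroup (D.H ≃ₐ[ℚ] D.H))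
    (σ θ : ℕ → (D.H ≃ₐ[ℚ] D.H)) (c : D.H ≃ₐ[ℚ] D.H) (hc : D.ConjSpec c)
    (hblock : ∀ d ∈ n.divisors, ((d % 8 = 5 ∨ d % 8 = 6) → D.CMBlockSpec d (z d) (Φ d) (ΓH d) (ΓH' d) (σ d) c) ∧
      (d % 8 = 7 → D.SevenBlockSpec d))
    (htheta : ∀ d ∈ n.divisors, d % 8 = 6 → D.ThetaBlockSpec d (z d) (ΓH d) (ΓH' d) (σ d) (θ d))
    (hFrob : ∀ d ∈ n.divisors, d % 8 = 6 → ∀ q : ℕ, q.Prime → q ∣ d → q ≠ 2 → ∃ φ : D.H ≃ₐ[ℚ] D.H,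
      φ (D.sqrtNeg d) = D.sqrtNeg d ∧ φ * φ ∈ ΓH' d ∧ φ D.im = (jacobiSym (-1) q) • D.im ∧
        ∀ r : ℕ, r.Prime → r ∣ n → r ≠ q → φ (D.sqrtNeg r) = (jacobiSym (-(r : ℤ)) q) • D.sqrtNeg r)
    (h11 : thm11_parity_of_scriptL)
    (hgenus : ∀ S : Finset (Fin k), (∑ j ∈ S, addLegendreSym (-1) (p j)) = 1 → coblockWeight p S = 1 → Odd (gK (2 * ∏ j ∈ S, p j)))
    (hsel : haveI := isElliptic_congruentNumberCurve (show n ≠ 0 by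
        rw [hn]; exact mul_ne_zero two_ne_zero (Finset.prod_ne_zero_iff.mpr fun i _ => (hp i).ne_zero));
      Nat.card ((congruentNumberCurve n).selmerGroup 2) = 8) :
    haveI := isElliptic_congruentNumberCurve (show n ≠ 0 by
      rw [hn]; exact mul_ne_zero two_ne_zero (Finset.prod_ne_zero_iff.mpr fun i _ => (hp i).ne_zero))
    (congruentNumberCurve n).analyticRank = 1 ∧ (congruentNumberCurve n).mordellWeilRank = 1 ∧
      AddCommGroup.primaryComponent (congruentNumberCurve n).sha 2 = ⊥ ∧
      BSDp (congruentNumberCurve n) 2 := by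
  have hp2 : ∀ i, p i ≠ 2 := ne_two_of_odd p hodd
  have ht1 : (∑ j, addLegendreSym (-1) (p j)) = 1 := by rw [sum_addLegendreSym_neg_one_eq p hp hp2, if_neg (by omega)]
  -- `g(n)` odd from the hypothesis at `S = univ`
  have hgn : Odd (gK (2 * ∏ i, p i)) := hgenus univ ht1 (coblockWeight_univ p)
  have hsel' : Nat.card ((congruentNumberCurve (2 * ∏ i, p i)).selmerGroup 2) = 8 := by subst hn; exact hsel
  obtain ⟨i, hi⟩ := exists_kerSum_monskyEven_inl_eq_one p hp hodd hinj hsel' hgn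
  have hadj : (monskyMatrixEven p).adjugate (Sum.inl i) (Sum.inr i) = 1 := by
    rw [adjugate_monskyEven_inl_inr_eq_kerSum p hp hodd hinj hsel' i, hi]
  have hgenus' : ∀ S : Finset (Fin k), i ∈ S → (∑ j ∈ S, addLegendreSym (-1) (p j)) = 1 → coblockWeight p S = 1 →
      Odd (gK (2 * ∏ j ∈ S, p j)) ∧
        Fintype.card {v : Fin S.card ⊕ Unit → ZMod 2 //
          (Matrix.fromBlocks (legendreMatrix (blockPrimes p S) + legendreDiagonal (blockPrimes p S) (-2))
            (Matrix.of fun j (_ : Unit) => addLegendreSym 2 (blockPrimes p S j))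
            (0 : Matrix Unit (Fin S.card) (ZMod 2)) (0 : Matrix Unit Unit (ZMod 2))) *ᵥ v = 0} = 2 := by
    intro S _ hS hcw
    have hg := hgenus S hS hcw
    refine ⟨hg, ?_⟩
    have hS' : (∑ t, addLegendreSym (-1) (blockPrimes p S t)) = 1 := by
      rw [← hS]
      simp only [blockPrimes_apply]
      rw [← sum_coe_sort S]
      exact (S.orderIsoOfFin rfl).toEquiv.sum_comp (fun x : {x // x ∈ S} => addLegendreSym (-1) (p (x : Fin k)))
    have hg' : Odd (gK (2 * ∏ t, blockPrimes p S t)) := by rw [prod_blockPrimes]; exact hg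
    exact card_ker_blockN_eq_two_of_odd_gK (blockPrimes p S) (blockPrimes_prime p hp S) (blockPrimes_odd p hodd S)
      (blockPrimes_injective p hinj S) hS' hg'
  exact rankOne_sha_bsdp_two_of_card_selmer_eight_six p hp hodd hinj D hn h3 hrec h35 hLs h318 z Φ ΓH ΓH' σ θ c hc hblock htheta hFrob
    h11 i hgenus' hadj hsel

end Summit.BirchSwinnertonDyer.PrintCf2.MoverAssembly

end
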